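import Summits.ResolutionOfSingularities.ResolutionOfSingularities.Theorems.MarkedTransferCampaignW24ReducedBridgeQ
import HarnessLib

/-!
# The LEVEL-`q` bridge at an ARBITRARY PRIME `p`, part 1: Hasse derivatives of `Φ_{q,r} G = x^r·G(x^q)` (`q = p^e`) in characteristic `p`
# and the base-`p` residue bookkeeping of passengers (HIRONAKA-L · cell `res-hironaka` · slot W2.4 «bottom-member re-run», one-variable REDUCED
# MODEL; the `p = 2` case is res-D-pv-020's `…ReducedBridgeQ.lean`, whose `q`-generic `Ψ_q/Φ_{q,r}/IsMultQ/ResIn` are reused here)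

**HONEST FRAMING.** OURS throughout: kernel theorems about OURS bookkeeping objects of the cell's one-variable reduced model
(`CampaignW24.ReducedBridge`, res-D-pv-020; `CampaignW24.ReducedRun`, res-D-pv-035). Nothing below is a statement of H. Hironaka's manuscript
[Hironaka2017] (lit key `paper:url-3343fd9e678b`), nothing asserts that any statement of it holds, nothing is a claim about resolution of
singularities in characteristic `p`; the manuscript stays «under review» (D-0012/D-0089). AI work, weaker than expert review. Written by
res-D-pv-020 (W2.4 lineage; own thread «n = 1 at every prime», after res-type-059's immortal runs at p = 5, 7 (p534226, p535754)).

## What is proved (`K` a field of characteristic `p`, `p` prime; `q = p^e`; `A ≤ r < q`)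
* §1 `natCast_choose_add_pow_mulP` (Lucas split at `q`, from the tree's `choose_add_pow_mul_add_pow_mul_modEq`),
  `hasseD_low_phiQP : ∂^{(A)}(Φ_{q,r} G) = C(r, A)·Φ_{q,r−A} G`, `hasseD_qmul_phiQP : ∂^{(q·c)}(Φ_{q,r} G) = Φ_{q,r}(D^{(c)} G)`.
* §2 `PairLTP p r r₀` (digit pair `(r % p, r / p)` lexicographically below that of `r₀`), `resIn_hasseD_qmul` (`∂^{(q·c)}` keeps residues),
  `hasseD_top_eq_zero_of_resInP : ∂^{(r₀)}R = 0` for a passenger with residues in `good ⊆ PairLTP p · r₀`.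
Hypotheses: each theorem's own binders; no FACT-LIST fact, no DEFECT binder. Standard axioms only.
-/

noncomputable section

set_option linter.dupNamespace false -- mandated namespace of this single-conjunct summit

namespace Summit.ResolutionOfSingularities.ResolutionOfSingularities.Theorems

namespace CampaignW24

namespace ReducedBridgeP

open Literature.RingTheory.MvPowerSeries (hasseDeriv coeff_hasseDeriv choose_add_pow_mul_add_pow_mul_modEq)
open CampaignW21 (hasseD)
open ReducedBridge

variable {K : Type} [Field K]

/-! ## §1 Hasse derivatives of `Φ_{q,r} G` in characteristic `p` (`q = p^e`) -/

section Hasse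

variable {p : ℕ} [hp : Fact p.Prime] [CharP K p] {e : ℕ}

/-- Lucas split at `q = p^e` in `K`: `C(r + q·c, A + q·c′) = C(r, A)·C(c, c′)` for `r, A < q`. [cite: Abad2019pBases, Lemma 6.2 (Lucas arithmetic; kernel bookkeeping)] -/
theorem natCast_choose_add_pow_mulP {r A : ℕ} (c c' : ℕ) (hr : r < p ^ e) (hA : A < p ^ e) :
    (((r + p ^ e * c).choose (A + p ^ e * c') : ℕ) : K) = ((r.choose A * c.choose c' : ℕ) : K) := by
  exact (CharP.natCast_eq_natCast K p).mpr (choose_add_pow_mul_add_pow_mul_modEq e c c' hr hA)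

/-- **`∂^{(A)}(Φ_{q,r} G) = C(r, A)·Φ_{q,r−A} G`** for `A ≤ r < q = p^e`. [cite: Abad2019pBases, Lemma 6.2 (Lucas arithmetic; kernel bookkeeping)] -/
theorem hasseD_low_phiQP {r A : ℕ} (hr : r < p ^ e) (hAr : A ≤ r) (G : PowerSeries K) :
    hasseD K 1 (Finsupp.single 0 A) (phiQ (p ^ e) (pow_ne_zero e hp.out.ne_zero) r G) =
      ((r.choose A : ℕ) : K) • phiQ (p ^ e) (pow_ne_zero e hp.out.ne_zero) (r - A) G := by
  have hq : (p ^ e : ℕ) ≠ 0 := pow_ne_zero e hp.out.ne_zero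
  have hqpos : 0 < p ^ e := pow_pos hp.out.pos e
  have hrA : r - A < p ^ e := by omega
  ext d
  show MvPowerSeries.coeff d (hasseDeriv (Finsupp.single 0 A) (phiQ (p ^ e) hq r G)) = _
  rw [coeff_hasseDeriv, prod_choose_fin_one, Finsupp.single_eq_same, map_smul, coeff_phiQ_of_lt hq hr, coeff_phiQ_of_lt hq hrA,
    smul_eq_mul]
  simp only [Finsupp.add_apply, Finsupp.single_eq_same]
  by_cases h : d 0 % p ^ e = r - A
  · have hd := eq_add_mul_div_of_mod_eq (q := p ^ e) h
    have h1 : (A + d 0) % p ^ e = r := by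
      rw [hd, show A + (r - A + p ^ e * (d 0 / p ^ e)) = r + p ^ e * (d 0 / p ^ e) by omega, Nat.add_mul_mod_self_left,
        Nat.mod_eq_of_lt hr]
    have h2 : (A + d 0) / p ^ e = d 0 / p ^ e := by
      conv_lhs => rw [hd, show A + (r - A + p ^ e * (d 0 / p ^ e)) = r + p ^ e * (d 0 / p ^ e) by omega]
      rw [Nat.add_mul_div_left _ _ hqpos, Nat.div_eq_of_lt hr, zero_add]
    rw [if_pos h1, if_pos h, h2]
    have h3 : A + d 0 = r + p ^ e * (d 0 / p ^ e) := by omega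
    rw [h3, show A = A + p ^ e * 0 by ring]
    rw [show r + p ^ e * (d 0 / p ^ e) = r + p ^ e * (d 0 / p ^ e) from rfl,
      natCast_choose_add_pow_mulP (d 0 / p ^ e) 0 hr (by omega), Nat.choose_zero_right, mul_one]
    simp
  · rw [if_neg h, mul_zero]
    split_ifs with h'
    · exfalso
      apply h
      have hd := eq_add_mul_div_of_mod_eq (q := p ^ e) h'
      have h2 : d 0 = (r - A) + p ^ e * ((A + d 0) / p ^ e) := by omega
      rw [h2, Nat.add_mul_mod_self_left, Nat.mod_eq_of_lt hrA]
    · rw [mul_zero]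

/-- **`∂^{(q·c)}(Φ_{q,r} G) = Φ_{q,r}(D^{(c)} G)`** for `r < q = p^e`. [cite: Abad2019pBases, Lemma 6.2 (Lucas arithmetic; kernel bookkeeping)] -/
theorem hasseD_qmul_phiQP {r : ℕ} (hr : r < p ^ e) (c : ℕ) (G : PowerSeries K) :
    hasseD K 1 (Finsupp.single 0 (p ^ e * c)) (phiQ (p ^ e) (pow_ne_zero e hp.out.ne_zero) r G) =
      phiQ (p ^ e) (pow_ne_zero e hp.out.ne_zero) r (ReducedRun.D c G) := by
  have hq : (p ^ e : ℕ) ≠ 0 := pow_ne_zero e hp.out.ne_zero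
  have hqpos : 0 < p ^ e := pow_pos hp.out.pos e
  ext d
  show MvPowerSeries.coeff d (hasseDeriv (Finsupp.single 0 (p ^ e * c)) (phiQ (p ^ e) hq r G)) = _
  rw [coeff_hasseDeriv, prod_choose_fin_one, Finsupp.single_eq_same, coeff_phiQ_of_lt hq hr, coeff_phiQ_of_lt hq hr]
  simp only [Finsupp.add_apply, Finsupp.single_eq_same]
  have hmod : (p ^ e * c + d 0) % p ^ e = d 0 % p ^ e := by rw [add_comm, Nat.add_mul_mod_self_left]
  rw [hmod]
  by_cases h : d 0 % p ^ e = r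
  · have hd := eq_add_mul_div_of_mod_eq (q := p ^ e) h
    have h2 : (p ^ e * c + d 0) / p ^ e = c + d 0 / p ^ e := by
      conv_lhs => rw [hd, show p ^ e * c + (r + p ^ e * (d 0 / p ^ e)) = r + p ^ e * (c + d 0 / p ^ e) by ring]
      rw [Nat.add_mul_div_left _ _ hqpos, Nat.div_eq_of_lt hr, zero_add]
    rw [if_pos h, if_pos h, h2, ReducedRun.coeff_D, add_comm (d 0 / p ^ e) c]
    have h3 : p ^ e * c + d 0 = r + p ^ e * (c + d 0 / p ^ e) := by
      conv_lhs => rw [hd]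
      ring
    rw [h3, show p ^ e * c = 0 + p ^ e * c by ring, natCast_choose_add_pow_mulP (c + d 0 / p ^ e) c hr hqpos, Nat.choose_zero_right,
      one_mul]
  · rw [if_neg h, if_neg h, mul_zero]

end Hasse

/-! ## §2 Base-`p` residue bookkeeping -/

/-- The digit pair of a residue read lexicographically with the FIRST base-`p` digit `r % p` dominant: `r` is below `r₀`. [folklore] -/
def PairLTP (p r r₀ : ℕ) : Prop := r % p < r₀ % p ∨ (r % p = r₀ % p ∧ r / p < r₀ / p)

omit [Field K] in
/-- `PairLTP` is irreflexive. [folklore] -/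
theorem PairLTP.ne {p r r₀ : ℕ} (h : PairLTP p r r₀) : r ≠ r₀ := by
  rintro rfl; rcases h with h | ⟨-, h⟩ <;> omega

section HasseRes

variable {p : ℕ} [hp : Fact p.Prime] {e : ℕ}

omit hp in
/-- `∂^{(q·c)}` keeps residues (it lowers exponents by a multiple of `q`). [folklore] -/
theorem resIn_hasseD_qmul {good : ℕ → Prop} {R : MvPowerSeries (Fin 1) K} (h : ResIn (p ^ e) good R) (c : ℕ) :
    ResIn (p ^ e) good (hasseD K 1 (Finsupp.single 0 (p ^ e * c)) R) := fun d hd => by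
  change MvPowerSeries.coeff d (hasseDeriv (Finsupp.single 0 (p ^ e * c)) R) ≠ 0 at hd
  rw [coeff_hasseDeriv] at hd
  have hR : MvPowerSeries.coeff (Finsupp.single 0 (p ^ e * c) + d) R ≠ 0 := fun h0 => hd (by rw [h0, mul_zero])
  have := h _ hR
  rwa [Finsupp.add_apply, Finsupp.single_eq_same, add_comm, Nat.add_mul_mod_self_left] at this

variable [CharP K p]

/-- **A passenger BELOW `r₀` is invisible to `∂^{(r₀)}`** (`r₀ < q = p^e`): `∂^{(r₀)} R = 0` — a residue whose digit pair is below that of `r₀`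
never dominates `r₀` digitwise (Lucas at `q`, then at `p`). [cite: Abad2019pBases, Lemma 6.2 (Lucas arithmetic; kernel bookkeeping)] -/
theorem hasseD_top_eq_zero_of_resInP {r₀ : ℕ} (hr₀ : r₀ < p ^ e) {good : ℕ → Prop} (hgood : ∀ ρ, good ρ → PairLTP p ρ r₀)
    {R : MvPowerSeries (Fin 1) K} (h : ResIn (p ^ e) good R) : hasseD K 1 (Finsupp.single 0 r₀) R = 0 := by
  ext d
  rw [MvPowerSeries.coeff_zero]
  show MvPowerSeries.coeff d (hasseDeriv (Finsupp.single 0 r₀) R) = 0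
  rw [coeff_hasseDeriv, prod_choose_fin_one, Finsupp.single_eq_same]
  by_cases hR : MvPowerSeries.coeff (Finsupp.single 0 r₀ + d) R = 0
  · rw [hR, mul_zero]
  · have hlt := hgood _ (h _ hR)
    rw [Finsupp.add_apply, Finsupp.single_eq_same] at hlt
    set m := r₀ + d 0 with hm
    have hsplit : ((m.choose r₀ : ℕ) : K) = (((m % p ^ e).choose r₀ * (m / p ^ e).choose 0 : ℕ) : K) := by
      have := natCast_choose_add_pow_mulP (K := K) (e := e) (r := m % p ^ e) (A := r₀) (m / p ^ e) 0
        (Nat.mod_lt _ (pow_pos hp.out.pos e)) hr₀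
      rwa [Nat.mod_add_div, mul_zero, add_zero] at this
    rw [hsplit, Nat.choose_zero_right, mul_one]
    set r := m % p ^ e with hr
    have h2 : ((r.choose r₀ : ℕ) : K) = (((r % p).choose (r₀ % p) * (r / p).choose (r₀ / p) : ℕ) : K) :=
      (CharP.natCast_eq_natCast K p).mpr (@Choose.choose_modEq_choose_mod_mul_choose_div_nat r r₀ p _)
    rw [h2]
    rcases hlt with hlt | ⟨-, hlt⟩
    · rw [Nat.choose_eq_zero_of_lt hlt, zero_mul, Nat.cast_zero, zero_mul]
    · rw [Nat.choose_eq_zero_of_lt hlt, mul_zero, Nat.cast_zero, zero_mul]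

end HasseRes

end ReducedBridgeP

end CampaignW24

end Summit.ResolutionOfSingularities.ResolutionOfSingularities.Theorems

end
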